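import Summits.BirchSwinnertonDyer.BirchSwinnertonDyer.Theorems.SylvesterTwoHeegnerIndexYinToricDefs
import Summits.BirchSwinnertonDyer.BirchSwinnertonDyer.Theorems.SylvesterTwoHeegnerIndexYinPointOfOnePoint
import Literature.NumberTheory.EllipticCurves.HeegnerPointsGaloisDescent
import HarnessLib

/-!
# Route `SylvesterTwoHeegnerIndex` (rung K7t): CONJECTURE C′ (stub (C′) of item 19804) and item 19802
# from the TORIC DECOMPOSITION of Yin's point — the kernel of the mechanism's last step (S5) + descent

Cell `bsd-cm`, seat `bsd-cm-two` (prover-bsd-cm-two-g9-0); file `--supports stmt-BirchSwinnertonDyer-19804`.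
PARTITION (D55): CornerF at `p = 2` (B14/O12) × {`x³ + y³ = p` : `p ≡ 7 (mod 9)` prime} × `p = 2` —
types-the-object-of; closes no cell and no item; BSD is not claimed; C′ and THEOREM C stay OPEN (the
toric inputs are HYPOTHESIS SHAPES, `…Theorems.SylvesterTwoHeegnerIndexYinToricDefs`).

THE MECHANISM (MEMO bsd-cm-two v2.10 §51–§52, FROZEN 08c1ecd6da1b763f; planner D138: DERIVED-CLAIM OF
RECORD for stub (C′)): at the inert supersingular prime `2` (`a₂(f) = 0`) the Hecke relation writes Yin's
point as `N·Z_p = −[ζ](R + cR) + T` over `L = K(i)` (`N = 9`, `c` = the involution of `K(i)/K`), and the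
anti-trace `R − cR` is a COHERENT sextic toric period, hence torsion (Tunnell–Saito / YZZ13 §1.3.2). This
file proves, in the kernel, everything AFTER those two inputs:

* §1 `exists_eq_two_smul_add_torsion_of_trace_of_antiTrace` — for ANY Weierstrass model `B/ℚ`, any
  Galois `L/K` (char. `0`) with `Gal(L/K) = {1, c}`, `B(L)[2] = 0`, `θ` additive, `N` odd:
  `N•ι(Y) = −θ(R + cR) + T` (`T` torsion) and `R − cR` torsion ⟹ `Y ∈ 2B(K) + B(K)_tors`. Proof:
  `R + cR = 2R − (R − cR)` (x1b GEN 52's `exists_eq_two_smul_add_torsion_of_odd_smul`) gives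
  `ι(Y) = 2Z′ + T₂` over `L`; `2(Z′ − cZ′)` is torsion, so `Z′ − cZ′` has ODD order `n` (no `2`-torsion);
  `nZ′` is Galois-fixed and DESCENDS (`exists_map_eq_of_forall_map_galois_eq`, the tree's proved Galois
  descent); `n·Y − 2Z₀` is torsion by injectivity of `ι`; `n` odd.
* §2 `exists_twoDivisible_displayPoint_of_toric` — `YinToricDecomposition` ⟹ the «one `2`-divisible display
  point per prime, `K` handed over» hypothesis of x1b GEN 52's `…_of_forall_field` theorems; hence
  `shaAnTwoIntegralSevenModNine_of_toric`, **`yinPointTwoDivisibleSevenModNine_of_toric :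
  PublishedFactsTwoYinToric → YinPointTwoDivisibleSevenModNine`** (the planner's D138 (c) target BY NAME),
  `hsyPointTwoDivisibleSevenModNine_of_factsPlus_of_toric` (THE LIVE ITEM 19802 BY NAME, granted
  `PublishedFactsTwoPlus`) and `upperOffV0HSYPlus_of_toric_of_offV0B` (item 19804 BY NAME from the toric
  binder and the member-Ш residual `hoffB` of two g8's reduction, planner D130).

NO definition, NO named fact, NO sorry; axioms standard; closes no item; nothing booked; no label moves.
References: Yin, arXiv:2607.01744 §2, Thm. 1.1, Thm. 2.2 (PRE); Yuan–Zhang–Zhang, Ann. of Math. Stud. 184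
(2013) §1.3.2, Thm. 1.3 (Tunnell 1983, Saito 1993); Silverman AEC VIII.§1 (Galois descent); MEMO bsd-cm-two
v2.10 §52; pub/bsd-cm STATUS 2026-08-27T05:04:35Z (D138), T05:40Z (x1b GEN 52, p499913).
-/

set_option autoImplicit false
-- the Summit-side namespace `Summit.BirchSwinnertonDyer.BirchSwinnertonDyer.…` (summit = problem) is mandated by D-0017
set_option linter.dupNamespace false

noncomputable section

open scoped Classical

open WeierstrassCurve WeierstrassCurve.Affine WeierstrassCurve.Affine.Point
open Summit.BirchSwinnertonDyer.BirchSwinnertonDyer.Theorems.SylvesterTwoYin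
  Summit.BirchSwinnertonDyer.BirchSwinnertonDyer.Theorems.SylvesterTwoYinOnePoint
  Literature.NumberTheory.EllipticCurves Literature.NumberTheory.EllipticCurves.HuShuYin2019

namespace Summit.BirchSwinnertonDyer.BirchSwinnertonDyer.Theorems.SylvesterTwoYinToric

/-! ## §1 The kernel of the toric step: trace relation + torsion anti-trace ⟹ `2`-divisibility over `K` -/

section Core

variable {K L : Type*} [Field K] [CharZero K] [Field L] [CharZero L] [Algebra K L]

/-- The Galois-descent lemma's inclusion `map (algebraMap K L).toRatAlgHom` is Mathlib's
`Point.baseChange K L` (same function on coordinates). [folklore] -/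
theorem map_toRatAlgHom_eq_baseChange (B : WeierstrassCurve ℚ) (P : (B.baseChange K).toAffine.Point) :
    Affine.Point.map (W' := B) (algebraMap K L).toRatAlgHom P =
      Affine.Point.baseChange (W' := B) K L P := by
  cases P <;> rfl

/-- In an additive commutative group without elements of order `2`, every torsion element has ODD order
(if the order were `2j`, then `j•Q` would be killed by `2`). [folklore] -/
theorem odd_addOrderOf_of_two_torsion_free {M : Type*} [AddCommGroup M]
    (h2 : ∀ Q : M, (2 : ℕ) • Q = 0 → Q = 0) {Q : M} (hQ : IsOfFinAddOrder Q) : Odd (addOrderOf Q) := by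
  by_contra hodd
  rw [Nat.not_odd_iff_even] at hodd
  obtain ⟨j, hj⟩ := hodd
  have hpos : 0 < addOrderOf Q := hQ.addOrderOf_pos
  have hjQ : (2 : ℕ) • (j • Q) = 0 := by
    rw [← mul_nsmul', show 2 * j = addOrderOf Q by omega]; exact addOrderOf_nsmul_eq_zero Q
  have hj0 : j • Q = 0 := h2 _ hjQ
  have hdvd : addOrderOf Q ∣ j := addOrderOf_dvd_of_nsmul_eq_zero hj0
  have hjpos : 0 < j := by omega
  have := Nat.le_of_dvd hjpos hdvd
  omega

/-- **THE KERNEL OF THE TORIC STEP (MEMO bsd-cm-two v2.10 §52.4–§52.7: (S2) + (S5) + descent).** `B/ℚ` a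
Weierstrass model, `L/K` a Galois extension of fields of characteristic `0` with `Gal(L/K) = {1, c}`,
`B(L)` without points of order `2`, `θ` an additive endomorphism of `B(L)` (the CM unit `[ζ]`), `N` odd.
If `N•ι(Y) = −θ(R + cR) + T` with `T` torsion (the TRACE RELATION delivered by `T₂` at the inert prime
and Shimura reciprocity) and the ANTI-TRACE `R − cR` is torsion (the vanishing of the coherent sextic
toric period), then `Y = 2Y′ + T′` in `B(K)` with `T′` torsion. Proof: `R + cR = 2R − (R − cR)` makes
`N•ι(Y)` twice a point modulo torsion, hence (odd `N`) `ι(Y) = 2Z′ + T₂`; applying `c`,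
`2(Z′ − cZ′) = cT₂ − T₂` is torsion, so `Z′ − cZ′` has finite — hence odd — order `n`; `nZ′` is
`Gal(L/K)`-fixed, so it descends to `Z₀ ∈ B(K)` (Galois descent, Silverman AEC VIII.§1, the tree's
`exists_map_eq_of_forall_map_galois_eq`); `ι(n•Y − 2Z₀) = nT₂` is torsion and `ι` is injective, so
`n•Y = 2Z₀ + T₃` with `n` odd. [folklore] -/
theorem exists_eq_two_smul_add_torsion_of_trace_of_antiTrace (B : WeierstrassCurve ℚ) [IsGalois K L]
    (c : L ≃ₐ[K] L) (hGal : ∀ σ : L ≃ₐ[K] L, σ = AlgEquiv.refl ∨ σ = c)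
    (hL2 : ∀ Q : (B.baseChange L).toAffine.Point, (2 : ℕ) • Q = 0 → Q = 0)
    (θ : (B.baseChange L).toAffine.Point →+ (B.baseChange L).toAffine.Point)
    {N : ℤ} (hN : Odd N) {Y : (B.baseChange K).toAffine.Point}
    {R T : (B.baseChange L).toAffine.Point} (hT : IsOfFinAddOrder T)
    (htrace : N • Affine.Point.baseChange (W' := B) K L Y =
      -(θ (R + Affine.Point.map (W' := B) (c : L →ₐ[K] L) R)) + T)
    (hanti : IsOfFinAddOrder (R - Affine.Point.map (W' := B) (c : L →ₐ[K] L) R)) :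
    ∃ Y' T' : (B.baseChange K).toAffine.Point, IsOfFinAddOrder T' ∧ Y = (2 : ℤ) • Y' + T' := by
  -- notation
  set ι : (B.baseChange K).toAffine.Point →+ (B.baseChange L).toAffine.Point :=
    Affine.Point.baseChange (W' := B) K L with hι
  set cL : (B.baseChange L).toAffine.Point →+ (B.baseChange L).toAffine.Point :=
    Affine.Point.map (W' := B) (c : L →ₐ[K] L) with hcL
  have hιinj : Function.Injective ι := Affine.Point.map_injective _
  have hcι : ∀ Q, cL (ι Q) = ι Q := fun Q ↦ by
    simp only [hcL, hι, Affine.Point.map_baseChange]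
  -- step 1: N • ι Y = 2 • (−θ R) + (θ (R − cR) + T)
  have h1 : N • ι Y = (2 : ℤ) • (-(θ R)) + (θ (R - cL R) + T) := by
    rw [htrace]
    have e : R + cL R = (2 : ℤ) • R - (R - cL R) := by rw [two_smul]; abel
    rw [e, map_sub, map_zsmul, smul_neg]
    abel
  have hT1 : IsOfFinAddOrder (θ (R - cL R) + T) := (θ.isOfFinAddOrder hanti).add hT
  -- step 2: ι Y = 2 • Z' + T₂
  obtain ⟨Z', T₂, hT₂, h2⟩ := exists_eq_two_smul_add_torsion_of_odd_smul hN hT1 h1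
  -- step 3: Z' − c Z' is torsion, of odd order n
  have h3 : (2 : ℤ) • (Z' - cL Z') = cL T₂ - T₂ := by
    have := congrArg cL h2
    rw [hcι, map_add, map_zsmul] at this
    -- ι Y = 2•cZ' + cT₂ and ι Y = 2•Z' + T₂
    have e : (2 : ℤ) • Z' + T₂ = (2 : ℤ) • cL Z' + cL T₂ := h2.symm.trans this
    rw [smul_sub]
    calc (2 : ℤ) • Z' - (2 : ℤ) • cL Z' = ((2 : ℤ) • Z' + T₂) - T₂ - (2 : ℤ) • cL Z' := by abel
      _ = ((2 : ℤ) • cL Z' + cL T₂) - T₂ - (2 : ℤ) • cL Z' := by rw [e]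
      _ = cL T₂ - T₂ := by abel
  have hs : IsOfFinAddOrder (Z' - cL Z') := by
    have hfin : IsOfFinAddOrder ((2 : ℤ) • (Z' - cL Z')) := by
      rw [h3, sub_eq_add_neg]; exact (cL.isOfFinAddOrder hT₂).add hT₂.neg
    obtain ⟨m, hm, hm0⟩ := hfin.exists_nsmul_eq_zero
    refine isOfFinAddOrder_iff_nsmul_eq_zero.mpr ⟨m * 2, by positivity, ?_⟩
    rw [mul_nsmul', show (2 : ℕ) • (Z' - cL Z') = (2 : ℤ) • (Z' - cL Z') from (natCast_zsmul _ 2).symm, hm0]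
  set n := addOrderOf (Z' - cL Z') with hn
  have hnodd : Odd n := odd_addOrderOf_of_two_torsion_free hL2 hs
  -- step 4: n • Z' is Galois-fixed, hence descends
  have hfix : cL ((n : ℤ) • Z') = (n : ℤ) • Z' := by
    rw [map_zsmul]
    have h0 : (n : ℤ) • (Z' - cL Z') = 0 := by
      rw [natCast_zsmul]; exact addOrderOf_nsmul_eq_zero _
    rw [smul_sub, sub_eq_zero] at h0
    exact h0.symm
  have hfixall : ∀ σ : L ≃ₐ[K] L,
      Affine.Point.map (W' := B) (σ : L →ₐ[K] L) ((n : ℤ) • Z') = (n : ℤ) • Z' := by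
    intro σ
    rcases hGal σ with rfl | rfl
    · exact Affine.Point.map_id _
    · exact hfix
  obtain ⟨Z₀, hZ₀⟩ := exists_map_eq_of_forall_map_galois_eq B hfixall
  rw [map_toRatAlgHom_eq_baseChange] at hZ₀
  -- step 5: n • Y = 2 • Z₀ + (torsion), with n odd
  have h5 : ι ((n : ℤ) • Y - (2 : ℤ) • Z₀) = (n : ℤ) • T₂ := by
    rw [map_sub, map_zsmul, map_zsmul, h2, smul_add, hι, hZ₀, smul_comm]
    abel
  have hT5 : IsOfFinAddOrder ((n : ℤ) • Y - (2 : ℤ) • Z₀) := by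
    have hfin : IsOfFinAddOrder (ι ((n : ℤ) • Y - (2 : ℤ) • Z₀)) := by
      rw [h5]; exact hT₂.zsmul
    obtain ⟨m, hm, hm0⟩ := hfin.exists_nsmul_eq_zero
    refine isOfFinAddOrder_iff_nsmul_eq_zero.mpr ⟨m, hm, hιinj ?_⟩
    rw [map_nsmul, hm0, AddMonoidHom.map_zero]
  have h6 : (n : ℤ) • Y = (2 : ℤ) • Z₀ + ((n : ℤ) • Y - (2 : ℤ) • Z₀) := by abel
  have hnZ : Odd (n : ℤ) := by exact_mod_cast hnodd
  exact exists_eq_two_smul_add_torsion_of_odd_smul hnZ hT5 h6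

end Core

/-! ## §2 From the toric decomposition to C′, item 19802 and item 19804 BY NAME -/

/-- **ONE `2`-DIVISIBLE DISPLAY POINT PER PRIME FROM THE TORIC DECOMPOSITION** — exactly the `K`-handed-over
hypothesis of x1b GEN 52's `…_of_forall_field` theorems: for every `p ≡ 7 (9)`, minimal `B ≅ E_p`, quadratic
`K ∋ ω` with `rank_ℤ B(K) = 2` and rational generator `P`, the display point `Y` of `YinToricDecomposition`
is `2Y′ + T′` by §1 (in the source: Yin's `[√−3]Z_p` transported to `B`, `L = K(i)`, `N = 9`).
[cite-level reading: arXiv:2607.01744 Thm. 1.1, Thm. 2.2; Yuan–Zhang–Zhang 2013 §1.3.2] -/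
theorem exists_twoDivisible_displayPoint_of_toric (hT : YinToricDecomposition) :
    ∀ (p : ℕ), p.Prime → p % 9 = 7 →
      ∀ (B : WeierstrassCurve ℚ) [B.IsElliptic] [B.IsGloballyMinimal],
      (∃ C : VariableChange ℚ, C • B = cubeSumCurve (p : ℚ)) → ∀ (qB : ℚ), shaAn B = (qB : ℂ) →
      ∀ (K : Type) [Field K] [NumberField K] (ω : K), ω ^ 2 + ω + 1 = 0 → Module.finrank ℚ K = 2 →
        (B.baseChange K).mordellWeilRank = 2 →
      ∀ (P : B.toAffine.Point), ¬ IsOfFinAddOrder (QuadraticDescent.incl K B P) →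
        (∀ Q : B.toAffine.Point, ∃ m : ℤ,
          IsOfFinAddOrder (QuadraticDescent.incl K B Q - m • QuadraticDescent.incl K B P)) →
      ∃ (Y : (B.baseChange K).toAffine.Point) (u : ℚ), u ≠ 0 ∧ padicValRat 2 u = 0 ∧
        ((u * qB : ℚ) : ℝ) * canonicalHeight (QuadraticDescent.incl K B P) =
          (2 : ℝ) ^ (-2 : ℤ) * canonicalHeight Y ∧
        ∃ Y' T' : (B.baseChange K).toAffine.Point, IsOfFinAddOrder T' ∧ Y = (2 : ℤ) • Y' + T' := by
  intro p hp h7 B _ _ hB qB hqB K _ _ ω hω h2K hrank P hP hgen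
  obtain ⟨Y, u, hu0, hu, hdisp, L, _, _, _, _, c, θ, N, R, T, hGal, hL2, hN, hTT, htr, hanti⟩ :=
    hT p hp h7 B hB qB hqB K ω hω h2K hrank P hP hgen
  exact ⟨Y, u, hu0, hu, hdisp,
    exists_eq_two_smul_add_torsion_of_trace_of_antiTrace B c hGal hL2 θ hN hTT htr hanti⟩

/-- **`2`-INTEGRALITY OF `#Ш_an(E_p)` ON `p ≡ 7 (9)` FROM THE TORIC BINDER** (`PublishedFactsTwoYinToric` =
Yin's display + the toric decomposition): x1b GEN 52's `shaAnTwoIntegralSevenModNine_of_forall_field`.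
[cite-level reading: arXiv:2607.01744 Thm. 1.1; Yuan–Zhang–Zhang 2013 §1.3.2] -/
theorem shaAnTwoIntegralSevenModNine_of_toric (h : PublishedFactsTwoYinToric) :
    ShaAnTwoIntegralSevenModNine :=
  shaAnTwoIntegralSevenModNine_of_forall_field h.1 (exists_twoDivisible_displayPoint_of_toric h.2)

/-- **CONJECTURE C′ FROM THE TORIC BINDER** — the planner's D138 (c) kernel target BY NAME:
`PublishedFactsTwoYinToric → YinPointTwoDivisibleSevenModNine`. C′ stays OPEN: the binder is a pair of
hypothesis shapes (Yin's PREPRINT display; the cell's DERIVED-CLAIM toric decomposition, MEMO v2.10 §52).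
[cite-level reading: arXiv:2607.01744 Thm. 1.1, p. 12; Yuan–Zhang–Zhang 2013 §1.3.2] -/
theorem yinPointTwoDivisibleSevenModNine_of_toric (h : PublishedFactsTwoYinToric) :
    YinPointTwoDivisibleSevenModNine :=
  yinPointTwoDivisibleSevenModNine_of_forall_field h.1 (exists_twoDivisible_displayPoint_of_toric h.2)

/-- **THE LIVE ITEM 19802 (THEOREM C) BY NAME FROM THE TORIC BINDER**, granted the route's support conjunction
`PublishedFactsTwoPlus`: x1b GEN 52's `hsyPointTwoDivisibleSevenModNine_of_factsPlus_of_forall_field`. A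
SECOND road to THEOREM C (no involution `σ_{−1}`, no `H_{9p}`, no cube condition). Nothing is closed.
[cite-level reading: arXiv:2607.01744 Thm. 1.1; HuShuYin2019 Thm. 1.4, p. 12] -/
theorem hsyPointTwoDivisibleSevenModNine_of_factsPlus_of_toric
    (hFP : Theses.SylvesterTwoHeegnerIndex.PublishedFactsTwoPlus) (h : PublishedFactsTwoYinToric) :
    Theses.SylvesterTwoHeegnerIndex.HSYPointTwoDivisibleSevenModNine :=
  hsyPointTwoDivisibleSevenModNine_of_factsPlus_of_forall_field hFP h.1
    (exists_twoDivisible_displayPoint_of_toric h.2)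

/-- **THE OFF-`𝒱₀` UPPER CRUX 19804 BY NAME FROM THE TORIC BINDER AND THE MEMBER-Ш RESIDUAL** (planner D130's
structure of record with its research stub (C′) replaced by the toric binder): two g8's
`upperOffV0HSYPlus_of_yin_of_offV0B` with `hC` supplied by `yinPointTwoDivisibleSevenModNine_of_toric`; `hoffB`
is the Kolyvagin-at-`2` residual on the members with `Ш(E_p)[2^∞] ≠ 1`. A reduction, not a proof.
[cite-level reading: arXiv:2607.01744 Thm. 1.1; HuShuYin2019 Thm. 1.4] -/
theorem upperOffV0HSYPlus_of_toric_of_offV0B (h : PublishedFactsTwoYinToric)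
    (hoffB : Theses.SylvesterTwoHeegnerIndex.PublishedFactsTwoPlus →
      ∀ (p : ℕ), p.Prime → (p % 9 = 4 ∨ p % 9 = 7) → (¬ ∃ x : ZMod p, x ^ 3 = 3) →
        ∀ (B : WeierstrassCurve ℚ) [B.IsElliptic] [B.IsGloballyMinimal],
          (∃ C : VariableChange ℚ, C • B = cubeSumCurve (p : ℚ)) →
          Nat.card (AddCommGroup.primaryComponent B.sha 2) ≠ 1 →
          Rank1Residual.Typed.MissingUpperBoundAt B 2) :
    Theses.SylvesterTwoHeegnerIndex.UpperOffV0HSYPlus :=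
  upperOffV0HSYPlus_of_yin_of_offV0B h.1 (yinPointTwoDivisibleSevenModNine_of_toric h) hoffB

end Summit.BirchSwinnertonDyer.BirchSwinnertonDyer.Theorems.SylvesterTwoYinToric

end
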